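import Summits.Ventures.HodgeRepro2.T5WeightSpaces

/-!
# Weight spaces as spaces of intertwiners

For a representation `π : K →* V →L[ℂ] V` and a character `χ : K →* ℂˣ`, the weight space
`V_χ = {v | ∀ k, π k v = χ k • v}` is canonically the space of intertwining maps from the
one-dimensional character representation `charRep χ` (on `ℂ`) into `π`:
`Hom_K(charRep χ, π) ≃ₗ V_χ`, `f ↦ f 1` (`weightSpaceEquivHom`).  Hence
`dim V_χ = dim Hom_K(charRep χ, π)` — the weight multiplicity is the intertwiner dimension,
matching `T5WeightSpaces.finrank_weightSpace_eq_integral` with `T5IntertwinerDimension`.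

Blind lane: Mathlib + own prefix only; no sorry; axioms ⊆ {propext, Classical.choice, Quot.sound}.
-/

namespace Summit.Ventures.HodgeRepro2.T5WeightSpaceHom

open T5WeightSpaces T5SchurMathlib

variable {K : Type*} [Group K] {V : Type*} [NormedAddCommGroup V] [InnerProductSpace ℂ V]

/-- An intertwiner `f : charRep χ → π` sends `1` to a weight vector of weight `χ`. -/
theorem apply_one_mem_weightSpace (π : K →* V →L[ℂ] V) (χ : K →* ℂˣ)
    (f : (toRep (charRep χ)).IntertwiningMap (toRep π)) : f 1 ∈ weightSpace π χ := by
  rw [mem_weightSpace]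
  intro k
  have h := Representation.IntertwiningMap.isIntertwining _ _ f k 1
  rw [toRep_apply, toRep_apply, charRep_apply, mul_one] at h
  rw [← h]
  have : ((χ k : ℂˣ) : ℂ) = ((χ k : ℂˣ) : ℂ) • (1 : ℂ) := by rw [smul_eq_mul, mul_one]
  conv_lhs => rw [this]
  rw [map_smul]

/-- The intertwiner `charRep χ → π` attached to a weight vector `v ∈ V_χ`: `c ↦ c • v`. -/
def intertwinerOfWeightVector (π : K →* V →L[ℂ] V) (χ : K →* ℂˣ) (v : weightSpace π χ) :
    (toRep (charRep χ)).IntertwiningMap (toRep π) where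
  toLinearMap := LinearMap.toSpanSingleton ℂ V (v : V)
  isIntertwining' k := by
    apply LinearMap.ext
    intro c
    simp only [LinearMap.comp_apply, LinearMap.toSpanSingleton_apply, toRep_apply, charRep_apply,
      map_smul, (mem_weightSpace π χ).1 v.2 k, mul_smul]
    rw [smul_comm]

/-- `intertwinerOfWeightVector π χ v c = c • v`. -/
theorem intertwinerOfWeightVector_apply (π : K →* V →L[ℂ] V) (χ : K →* ℂˣ) (v : weightSpace π χ)
    (c : ℂ) : intertwinerOfWeightVector π χ v c = c • (v : V) := rfl

/-- **Weight spaces are spaces of intertwiners**: `Hom_K(charRep χ, π) ≃ₗ[ℂ] V_χ`, `f ↦ f 1`. -/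
noncomputable def weightSpaceEquivHom (π : K →* V →L[ℂ] V) (χ : K →* ℂˣ) :
    (toRep (charRep χ)).IntertwiningMap (toRep π) ≃ₗ[ℂ] weightSpace π χ where
  toFun f := ⟨f 1, apply_one_mem_weightSpace π χ f⟩
  invFun v := intertwinerOfWeightVector π χ v
  map_add' f g := by
    ext
    simp only [Representation.IntertwiningMap.coe_add, Pi.add_apply, Submodule.coe_add]
  map_smul' a f := by
    ext
    simp only [Representation.IntertwiningMap.coe_smul, Pi.smul_apply, Submodule.coe_smul,
      RingHom.id_apply]
  left_inv f := by
    apply Representation.IntertwiningMap.ext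
    apply LinearMap.ext
    intro c
    rw [Representation.IntertwiningMap.coe_toLinearMap, Representation.IntertwiningMap.coe_toLinearMap,
      intertwinerOfWeightVector_apply]
    have : c = c • (1 : ℂ) := by rw [smul_eq_mul, mul_one]
    conv_rhs => rw [this, map_smul]
  right_inv v := by
    ext
    simp only [intertwinerOfWeightVector_apply, one_smul]

/-- `dim V_χ = dim Hom_K(charRep χ, π)`. -/
theorem finrank_weightSpace_eq_finrank_intertwiningMap (π : K →* V →L[ℂ] V) (χ : K →* ℂˣ) :
    Module.finrank ℂ (weightSpace π χ) =
      Module.finrank ℂ ((toRep (charRep χ)).IntertwiningMap (toRep π)) :=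
  (LinearEquiv.finrank_eq (weightSpaceEquivHom π χ)).symm

end Summit.Ventures.HodgeRepro2.T5WeightSpaceHom
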